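import Mathlib
import Summits.ValiantsHypothesis.ValiantsHypothesis.Theorems.LacunarySymmetroidMatrixDescartesStubDetCurve
import Summits.ValiantsHypothesis.ValiantsHypothesis.Theorems.LacunarySymmetroidMatrixDescartesDetLorentzianNonneg
import Summits.ValiantsHypothesis.ValiantsHypothesis.Theorems.LacunarySymmetroidMatrixDescartesDetLorentzianDefinite
import Summits.ValiantsHypothesis.ValiantsHypothesis.Theorems.LacunarySymmetroidMatrixDescartesDetLorentzianNewtonWindow

/-!
# ValiantsHypothesis / LacunarySymmetroid — crux `MatrixDescartes` (stmt-ValiantsHypothesis-18050), line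
# `lorentzian_shadow` :: `stub_detLorentzian`: CLAUSE (d) (Hessian signature) FOR `K = 2` — two positive definite
# matrices, every size `m`

Helper file (`--supports stmt-ValiantsHypothesis-18050 --as helper`; cell val-lit, seat val-lit-p5 g9, merged desk
RULINGS #90/#91 [L4]).  Closes NO item; theorem-only, 0 facts.  «V1 line helper; `MatrixDescartes` /
Conjecture B / `VP ≠ VNP` OPEN.»  Uses BY NAME: p4's `DetCurve.stub_detCurve` (curve restriction of the coefficient
array) and `DetLorentzianDefinite.exists_gram_of_posDef`, p7's `DetLorentzian.detArray_eq_zero_of_not_mem_layer`,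
and this seat's `NewtonWindow.newton_window`.

* **`card_roots_det_pencil_eq`** — REAL-ROOTEDNESS: for `A₀ ≻ 0` and `A₁` symmetric, the polynomial
  `P = det (X • A₀ + A₁)` has `natDegree P = m` and `m` real roots counted with multiplicity
  (`A₀ = Sᵀ S`, `P = (det S)² · charpoly(-S⁻ᵀ A₁ S⁻¹)`, and the characteristic polynomial of a real symmetric matrix
  splits — `Matrix.IsHermitian.charpoly_eq`);
* `coeff_det_pencil_eq_detArray` — BRIDGE: `coeff_j P` is the coefficient `[s₀^j s₁^{m-j}] det (s₀ A₀ + s₁ A₁)` of the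
  line's `detArray m 2 A` (from `stub_detCurve` on the curve `σ = (+,+)`, `e = (1, 0)`);
* `gram_two` — for a symmetric `2 × 2` matrix, `(vᵀHv)(wᵀHw) − (vᵀHw)² = det H · (v₀w₁ − v₁w₀)²`, so
  `AtMostOnePosEig H` follows from `det H ≤ 0`;
* **`atMostOnePosEig_hessAt_detArray_pencilTwo`** — CLAUSE (d) of `IsLorentzianArray m 2 (detArray m 2 A)` for
  `A₀, A₁ ≻ 0`, in the line's unfolded currency: for every `γ` with `γ₀ + γ₁ = m − 2`, the Hessian
  `hessAt (detArray m 2 A) γ` has at most one positive eigenvalue.  Its determinant inequality is exactly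
  `newton_window` at `k = γ₀ + 1`; `m < 2` is vacuous by p7's clause (b).

Residual for `stub_detLorentzian` (NOT here): (d) for `K ≥ 3`, `m ≥ 3` (Gårding hyperbolicity / Brändén–Huh);
the semidefinite closure of this file's definite case (limit `A_l + ε·1`).
-/

set_option linter.dupNamespace false

namespace Summit.ValiantsHypothesis.ValiantsHypothesis.Theorems.LacunarySymmetroidMatrixDescartes

open Polynomial Matrix Finset

namespace PencilTwo

variable {m : ℕ}

/-! ## 1. Real-rootedness of `det (X • A₀ + A₁)` -/

/-- `X • 1 + M` (entries mapped) is the characteristic matrix of `-M`. -/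
theorem charmatrix_neg (M : Matrix (Fin m) (Fin m) ℝ) :
    charmatrix (-M) = (X : ℝ[X]) • (1 : Matrix (Fin m) (Fin m) ℝ[X]) + M.map C := by
  ext i j
  rw [charmatrix_apply, Matrix.add_apply, Matrix.smul_apply, Matrix.map_apply, Matrix.neg_apply, map_neg,
    Matrix.one_apply, Matrix.diagonal_apply]
  split_ifs <;> simp

/-- The characteristic polynomial of a real symmetric matrix has all its roots real. -/
theorem card_roots_charpoly_of_isSymm (M : Matrix (Fin m) (Fin m) ℝ) (hM : M.IsSymm) :
    Multiset.card M.charpoly.roots = m ∧ M.charpoly.natDegree = m := by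
  have hH : M.IsHermitian := by
    rw [Matrix.IsHermitian, conjTranspose_eq_transpose_of_trivial]; exact hM
  refine ⟨?_, Matrix.charpoly_natDegree_eq_dim M |>.trans (Fintype.card_fin m)⟩
  rw [hH.charpoly_eq]
  have : (∏ i : Fin m, (X - C (RCLike.ofReal (hH.eigenvalues i) : ℝ))) =
      ((Finset.univ.val.map fun i : Fin m => (hH.eigenvalues i : ℝ)).map fun a => X - C a).prod := by
    rw [Multiset.map_map, Finset.prod_eq_multiset_prod]; rfl
  rw [this, roots_multiset_prod_X_sub_C, Multiset.card_map, ← Finset.card_def, Finset.card_univ, Fintype.card_fin]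

/-- **Real-rootedness of a definite symmetric pencil.**  For `A₀ ≻ 0` and `A₁` symmetric,
`P = det (X • A₀ + A₁)` has degree `m` and `m` real roots counted with multiplicity. -/
theorem card_roots_det_pencil_eq (A₀ A₁ : Matrix (Fin m) (Fin m) ℝ) (h₀ : A₀.PosDef) (h₁ : A₁.IsSymm) :
    Multiset.card ((X : ℝ[X]) • A₀.map C + A₁.map C).det.roots = m ∧
      ((X : ℝ[X]) • A₀.map C + A₁.map C).det.natDegree = m := by
  obtain ⟨S, hS, hSu⟩ := DetLorentzianDefinite.exists_gram_of_posDef h₀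
  have hdetS : S.det ≠ 0 := by
    have := (Matrix.isUnit_iff_isUnit_det S).mp hSu
    exact this.ne_zero
  -- the congruent symmetric matrix N = S⁻ᵀ A₁ S⁻¹
  set N : Matrix (Fin m) (Fin m) ℝ := S⁻¹ᵀ * A₁ * S⁻¹ with hN
  have hNsymm : N.IsSymm := by
    unfold Matrix.IsSymm
    rw [hN, Matrix.transpose_mul, Matrix.transpose_mul, Matrix.transpose_transpose, h₁.eq, Matrix.mul_assoc]
  have hSinv : S⁻¹ * S = 1 := Matrix.nonsing_inv_mul S ((Matrix.isUnit_iff_isUnit_det S).mp hSu)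
  have hSinv' : S * S⁻¹ = 1 := Matrix.mul_nonsing_inv S ((Matrix.isUnit_iff_isUnit_det S).mp hSu)
  have hconj : Sᵀ * N * S = A₁ := by
    rw [hN, ← Matrix.mul_assoc, ← Matrix.mul_assoc, ← Matrix.transpose_mul, hSinv, Matrix.transpose_one,
      Matrix.one_mul, Matrix.mul_assoc, hSinv, Matrix.mul_one]
  -- the polynomial matrix identity
  have hmat : (X : ℝ[X]) • A₀.map C + A₁.map C = (S.map C)ᵀ * (charmatrix (-N)) * S.map C := by
    rw [charmatrix_neg, Matrix.mul_add, Matrix.add_mul, Matrix.mul_smul, Matrix.smul_mul, Matrix.mul_one,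
      ← Matrix.transpose_map, ← Matrix.map_mul, ← hS, ← Matrix.map_mul, ← Matrix.map_mul, hconj]
  have hdet : ((X : ℝ[X]) • A₀.map C + A₁.map C).det = Polynomial.C (S.det ^ 2) * (-N).charpoly := by
    rw [hmat, Matrix.det_mul, Matrix.det_mul, Matrix.det_transpose, Matrix.charpoly]
    have : (S.map C).det = Polynomial.C S.det := by
      rw [show S.map C = (Polynomial.C : ℝ →+* ℝ[X]).mapMatrix S from rfl, ← RingHom.map_det]
    rw [this, map_pow]; ring
  have hc : S.det ^ 2 ≠ 0 := pow_ne_zero 2 hdetS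
  have hneg : (-N).IsSymm := by unfold Matrix.IsSymm; rw [Matrix.transpose_neg, hNsymm.eq]
  obtain ⟨hroots, hdeg⟩ := card_roots_charpoly_of_isSymm (-N) hneg
  refine ⟨?_, ?_⟩
  · rw [hdet, roots_C_mul _ hc, hroots]
  · rw [hdet, natDegree_C_mul hc, hdeg]

/-! ## 2. Bridge to the line's coefficient array -/

/-- The `j`-th coefficient of `det (X • A₀ + A₁)` is the coefficient `[s₀^j s₁^{m-j}] det (s₀ A₀ + s₁ A₁)` of the
line's `detArray m 2 A` (p4's `DetCurve.stub_detCurve` on the curve `s₀ = X`, `s₁ = 1`). -/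
theorem coeff_det_pencil_eq_detArray (A : Fin 2 → Matrix (Fin m) (Fin m) ℝ) (j : ℕ) (hj : j ≤ m) :
    ((X : ℝ[X]) • (A 0).map C + (A 1).map C).det.coeff j =
      MvPolynomial.coeff (Finsupp.equivFunOnFinite.symm (![j, m - j] : Fin 2 → ℕ))
        (Matrix.det (∑ l, (MvPolynomial.X l : MvPolynomial (Fin 2) ℝ) • (A l).map MvPolynomial.C)) := by
  classical
  have h := DetCurve.stub_detCurve m 2 A (fun _ => true) ![1, 0]
  simp only [if_true, one_smul, one_pow, Finset.prod_const_one, one_mul, Fin.sum_univ_two,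
    Matrix.cons_val_zero, Matrix.cons_val_one, pow_one, pow_zero, zero_mul,
    add_zero] at h
  rw [h, finsetSum_coeff]
  simp only [Polynomial.coeff_C_mul_X_pow]
  rw [Finset.sum_eq_single_of_mem (![j, m - j] : Fin 2 → ℕ)]
  · simp
  · simp only [Finset.mem_filter, Fintype.mem_piFinset, Finset.mem_range, Matrix.cons_val_zero,
      Matrix.cons_val_one]
    refine ⟨fun i => ?_, by omega⟩
    fin_cases i
    all_goals simp
    all_goals omega
  · intro α hα hne
    rw [if_neg]
    intro hj0
    apply hne
    simp only [Finset.mem_filter, Fintype.mem_piFinset, Finset.mem_range] at hα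
    have h2 := hα.2
    ext i
    fin_cases i
    · simp [hj0]
    · simp at hj0 ⊢
      omega

/-! ## 3. The `2 × 2` Gram identity -/

/-- For a symmetric `2 × 2` matrix `H`: `(vᵀHv)(wᵀHw) − (vᵀHw)² = det H · (v₀w₁ − v₁w₀)²`. -/
theorem gram_two (H : Matrix (Fin 2) (Fin 2) ℝ) (hH : H 0 1 = H 1 0) (v w : Fin 2 → ℝ) :
    (v ⬝ᵥ (H *ᵥ v)) * (w ⬝ᵥ (H *ᵥ w)) - (v ⬝ᵥ (H *ᵥ w)) ^ 2 =
      (H 0 0 * H 1 1 - H 0 1 * H 1 0) * (v 0 * w 1 - v 1 * w 0) ^ 2 := by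
  simp only [dotProduct, Matrix.mulVec, Fin.sum_univ_two]
  rw [hH]; ring

/-- `det H ≤ 0` for a symmetric `2 × 2` matrix gives the line's `AtMostOnePosEig H` (unfolded). -/
theorem atMostOnePosEig_of_det_nonpos (H : Matrix (Fin 2) (Fin 2) ℝ) (hH : H 0 1 = H 1 0)
    (hdet : H 0 0 * H 1 1 - H 0 1 * H 1 0 ≤ 0) :
    ∀ v w : Fin 2 → ℝ, 0 < v ⬝ᵥ (H *ᵥ v) →
      (v ⬝ᵥ (H *ᵥ v)) * (w ⬝ᵥ (H *ᵥ w)) ≤ (v ⬝ᵥ (H *ᵥ w)) ^ 2 := by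
  intro v w _
  have h := gram_two H hH v w
  nlinarith [sq_nonneg (v 0 * w 1 - v 1 * w 0)]

/-! ## 4. Clause (d) for `K = 2`, positive definite pairs -/

/-- Multi-indices `γ + e_i + e_j` on `Fin 2`, as literal vectors. -/
theorem add_single_single_eq (γ : Fin 2 → ℕ) (i j : Fin 2) :
    γ + Pi.single i 1 + Pi.single j 1 =
      ![γ 0 + (if i = 0 then 1 else 0) + (if j = 0 then 1 else 0),
        γ 1 + (if i = 1 then 1 else 0) + (if j = 1 then 1 else 0)] := by
  ext l
  fin_cases l <;> fin_cases i <;> fin_cases j <;> simp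

/-- **Clause (d) of `IsLorentzianArray m 2 (detArray m 2 A)` for positive definite `A₀, A₁`** (the line's
`layer`, `hessAt`, `factWeight`, `detArray`, `AtMostOnePosEig` unfolded): every Hessian block
`hessAt (detArray m 2 A) γ`, `γ₀ + γ₁ = m − 2`, has at most one positive eigenvalue.  [Newton's inequalities for
the real-rooted `det (X • A₀ + A₁)`.] -/
theorem atMostOnePosEig_hessAt_detArray_pencilTwo (m : ℕ) (A : Fin 2 → Matrix (Fin m) (Fin m) ℝ)
    (hA : ∀ l, (A l).PosDef) :
    ∀ γ ∈ (Fintype.piFinset fun _ : Fin 2 => Finset.range (m - 2 + 1)).filter (fun γ => ∑ i, γ i = m - 2),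
      ∀ v w : Fin 2 → ℝ,
        0 < v ⬝ᵥ ((fun i j : Fin 2 =>
              ((∏ l, ((γ + Pi.single i 1 + Pi.single j 1 : Fin 2 → ℕ) l).factorial : ℕ) : ℝ) *
                MvPolynomial.coeff (Finsupp.equivFunOnFinite.symm (γ + Pi.single i 1 + Pi.single j 1))
                  (Matrix.det (∑ l, (MvPolynomial.X l : MvPolynomial (Fin 2) ℝ) • (A l).map MvPolynomial.C))) *ᵥ v) →
        (v ⬝ᵥ ((fun i j : Fin 2 =>
              ((∏ l, ((γ + Pi.single i 1 + Pi.single j 1 : Fin 2 → ℕ) l).factorial : ℕ) : ℝ) *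
                MvPolynomial.coeff (Finsupp.equivFunOnFinite.symm (γ + Pi.single i 1 + Pi.single j 1))
                  (Matrix.det (∑ l, (MvPolynomial.X l : MvPolynomial (Fin 2) ℝ) • (A l).map MvPolynomial.C))) *ᵥ v)) *
          (w ⬝ᵥ ((fun i j : Fin 2 =>
              ((∏ l, ((γ + Pi.single i 1 + Pi.single j 1 : Fin 2 → ℕ) l).factorial : ℕ) : ℝ) *
                MvPolynomial.coeff (Finsupp.equivFunOnFinite.symm (γ + Pi.single i 1 + Pi.single j 1))
                  (Matrix.det (∑ l, (MvPolynomial.X l : MvPolynomial (Fin 2) ℝ) • (A l).map MvPolynomial.C))) *ᵥ w)) ≤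
          (v ⬝ᵥ ((fun i j : Fin 2 =>
              ((∏ l, ((γ + Pi.single i 1 + Pi.single j 1 : Fin 2 → ℕ) l).factorial : ℕ) : ℝ) *
                MvPolynomial.coeff (Finsupp.equivFunOnFinite.symm (γ + Pi.single i 1 + Pi.single j 1))
                  (Matrix.det (∑ l, (MvPolynomial.X l : MvPolynomial (Fin 2) ℝ) • (A l).map MvPolynomial.C))) *ᵥ w)) ^ 2 := by
  classical
  intro γ hγ
  set c : (Fin 2 → ℕ) → ℝ := fun α => MvPolynomial.coeff (Finsupp.equivFunOnFinite.symm α)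
    (Matrix.det (∑ l, (MvPolynomial.X l : MvPolynomial (Fin 2) ℝ) • (A l).map MvPolynomial.C)) with hcdef
  set H : Matrix (Fin 2) (Fin 2) ℝ := fun i j =>
    ((∏ l, ((γ + Pi.single i 1 + Pi.single j 1 : Fin 2 → ℕ) l).factorial : ℕ) : ℝ) * c (γ + Pi.single i 1 + Pi.single j 1)
    with hHdef
  have hsymm : H 0 1 = H 1 0 := by
    simp only [hHdef]
    rw [show γ + Pi.single 0 1 + Pi.single 1 1 = γ + Pi.single 1 1 + Pi.single 0 1 from by
      rw [add_assoc, add_assoc, add_comm (Pi.single 0 1)]]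
  refine atMostOnePosEig_of_det_nonpos H hsymm ?_
  simp only [Finset.mem_filter, Fintype.mem_piFinset, Finset.mem_range, Fin.sum_univ_two] at hγ
  obtain ⟨hγr, hγs⟩ := hγ
  -- the three multi-indices
  have e00 : γ + Pi.single (0 : Fin 2) 1 + Pi.single (0 : Fin 2) 1 = ![γ 0 + 2, γ 1] := by
    rw [add_single_single_eq]; simp
  have e11 : γ + Pi.single (1 : Fin 2) 1 + Pi.single (1 : Fin 2) 1 = ![γ 0, γ 1 + 2] := by
    rw [add_single_single_eq]; simp
  have e01 : γ + Pi.single (0 : Fin 2) 1 + Pi.single (1 : Fin 2) 1 = ![γ 0 + 1, γ 1 + 1] := by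
    rw [add_single_single_eq]; simp
  have e10 : γ + Pi.single (1 : Fin 2) 1 + Pi.single (0 : Fin 2) 1 = ![γ 0 + 1, γ 1 + 1] := by
    rw [add_single_single_eq]; simp
  have hfw : ∀ a b : ℕ, ((∏ l : Fin 2, ((![a, b] : Fin 2 → ℕ) l).factorial : ℕ) : ℝ) =
      (a.factorial : ℝ) * (b.factorial : ℝ) := by
    intro a b; rw [Fin.prod_univ_two]; push_cast; simp
  rcases lt_or_ge m 2 with hm | hm
  · -- m < 2: all degree-2 coefficients vanish, H = 0
    have hz : ∀ a b : ℕ, a + b = 2 → c ![a, b] = 0 := by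
      intro a b hab
      apply DetLorentzian.detArray_eq_zero_of_not_mem_layer
      simp only [Finset.mem_filter, Fintype.mem_piFinset, Finset.mem_range, Fin.sum_univ_two,
        Matrix.cons_val_zero, Matrix.cons_val_one, not_and]
      intro _; omega
    have hγ0 : γ 0 = 0 := by have := hγr 0; omega
    have hγ1 : γ 1 = 0 := by have := hγr 1; omega
    have h00 : H 0 0 = 0 := by
      simp only [hHdef]; rw [e00, hγ0, hγ1, hz 2 0 rfl, mul_zero]
    have h11 : H 1 1 = 0 := by
      simp only [hHdef]; rw [e11, hγ0, hγ1, hz 0 2 rfl, mul_zero]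
    rw [h00, h11, ← hsymm]
    nlinarith [sq_nonneg (H 0 1)]
  · -- m ≥ 2: Newton's inequality for P = det (X • A₀ + A₁) at k = γ 0 + 1
    have hkm : γ 0 + 1 + 1 ≤ m := by omega
    have hsym1 : (A 1).IsSymm := by
      have := (hA 1).isHermitian
      rwa [Matrix.IsHermitian, conjTranspose_eq_transpose_of_trivial] at this
    obtain ⟨hroots, hdeg⟩ := card_roots_det_pencil_eq (A 0) (A 1) (hA 0) hsym1
    set P := ((X : ℝ[X]) • (A 0).map C + (A 1).map C).det with hP
    have hRR : Multiset.card P.roots = P.natDegree := by rw [hroots, hdeg]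
    have hN := NewtonWindow.newton_window P hRR (γ 0 + 1) (by omega) (by rw [hdeg]; exact hkm)
    rw [hdeg, Nat.add_sub_cancel, show m - (γ 0 + 1) - 1 = γ 1 by omega,
      show m - (γ 0 + 1) + 1 = γ 1 + 2 by omega, show m - (γ 0 + 1) = γ 1 + 1 by omega] at hN
    -- identify the coefficients
    have hc0 : P.coeff (γ 0) = c ![γ 0, γ 1 + 2] := by
      rw [hP, coeff_det_pencil_eq_detArray A (γ 0) (by omega), show m - γ 0 = γ 1 + 2 by omega]
    have hc1 : P.coeff (γ 0 + 1) = c ![γ 0 + 1, γ 1 + 1] := by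
      rw [hP, coeff_det_pencil_eq_detArray A (γ 0 + 1) (by omega), show m - (γ 0 + 1) = γ 1 + 1 by omega]
    have hc2 : P.coeff (γ 0 + 1 + 1) = c ![γ 0 + 2, γ 1] := by
      rw [hP, coeff_det_pencil_eq_detArray A (γ 0 + 1 + 1) hkm, show m - (γ 0 + 1 + 1) = γ 1 by omega]
    have hH00 : H 0 0 = ((γ 0 + 2).factorial : ℝ) * ((γ 1).factorial : ℝ) * c ![γ 0 + 2, γ 1] := by
      simp only [hHdef]; rw [e00, hfw]
    have hH11 : H 1 1 = ((γ 0).factorial : ℝ) * ((γ 1 + 2).factorial : ℝ) * c ![γ 0, γ 1 + 2] := by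
      simp only [hHdef]; rw [e11, hfw]
    have hH01 : H 0 1 = ((γ 0 + 1).factorial : ℝ) * ((γ 1 + 1).factorial : ℝ) * c ![γ 0 + 1, γ 1 + 1] := by
      simp only [hHdef]; rw [e01, hfw]
    rw [← hsymm, hH00, hH11, hH01, ← hc0, ← hc1, ← hc2]
    have hX : ((γ 0 + 2).factorial : ℝ) * ((γ 1).factorial : ℝ) * P.coeff (γ 0 + 1 + 1) *
        (((γ 0).factorial : ℝ) * ((γ 1 + 2).factorial : ℝ) * P.coeff (γ 0)) =
        P.coeff (γ 0) * P.coeff (γ 0 + 1 + 1) *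
          (((γ 0).factorial : ℝ) * ((γ 0 + 1 + 1).factorial : ℝ) * ((γ 1 + 2).factorial : ℝ) *
            ((γ 1).factorial : ℝ)) := by
      rw [show γ 0 + 2 = γ 0 + 1 + 1 by ring]; ring
    have hY : ((γ 0 + 1).factorial : ℝ) * ((γ 1 + 1).factorial : ℝ) * P.coeff (γ 0 + 1) *
        (((γ 0 + 1).factorial : ℝ) * ((γ 1 + 1).factorial : ℝ) * P.coeff (γ 0 + 1)) =
        (P.coeff (γ 0 + 1) * (((γ 0 + 1).factorial : ℝ) * ((γ 1 + 1).factorial : ℝ))) ^ 2 := by ring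
    rw [hX, hY]
    linarith [hN]

end PencilTwo

end Summit.ValiantsHypothesis.ValiantsHypothesis.Theorems.LacunarySymmetroidMatrixDescartes
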